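/-
Copyright: width seat `ym-line-sll-p4` (prover-ym-line-sll-p4-g0-0), route `SoftLoopLongLag`, cruxes K′ `SoftLoopLagFloorToTorus`
(stmt-QuantumFields-22504) / T′ `ColdBoxSoftLoopLagFloor` (stmt-QuantumFields-24180), line `birth` — engine layer R3-loop of the
E-architecture (shared by E1a, E1b, E2): the LOOP cost in the exponential chart is the half-sum of squared linear surface fluxes.
-/
import Summits.QuantumFields.YangMills.Theorems.SoftLoopLongLagLoopCostCubic
import Summits.QuantumFields.YangMills.Theorems.SoftLoopLongLagColdBoxSoftLoopLagFloorStubGaussCore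
import Summits.QuantumFields.YangMills.Theorems.ColdBoxAllGroupsBulkAllGroupsLinearisedDatumEnergyG
import Summits.QuantumFields.YangMills.Theorems.ColdBoxAllGroupsBulkAllGroupsDatumSplitG
import Literature.MathematicalPhysics.QuantumLattice.CentreSymmetryConfinementProofs

/-!
# Route `SoftLoopLongLag`, line `birth` (both cruxes), engine layer R3-loop: the cost of an `R×T` Wilson LOOP whose links are chart
# points is the half-sum over colours of the squared linear SURFACE FLUXES of the chart coordinates, up to `9·(2(R+T)m)³`

The loop analogue, for every compact group presented in `U(N)` (continuous `ρ : G →* U(N)`, exponential chart `expChart ρ`, `D = dimE ρ`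
colours), of the sibling's plaquette brick `abs_plaqCostAt_sub_half_sum_sq_le_of_eq_expChart` (`…BulkAllGroupsLinearisedDatumEnergyG`):
for a configuration `U` agreeing with the chart points `expChart ρ (a e)` of coordinates `‖a e‖ ≤ m` and a rectangle `rectWalk x 1 2 R T`
with `2(R+T)·m ≤ 1/4`,

  `|(N − Re tr ρ(hol_{R×T at x}(U))) − ½ Σ_c (Σ_{p ∈ rectSurface x R T} sCirc (e ↦ (a e)_c) p)²| ≤ 9·(2(R+T)·m)³`

(`abs_loopCost_sub_half_sum_sq_le_of_eq_expChart`).  Ingredients: the lead's list cubic remainder `abs_cost_expChart_listProd_sub_half_norm_sq_le`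
(`…LoopCostCubic`, `|(N − Re tr Π_k e^{lieIso ρ a_k}) − ½‖Σ_k a_k‖²| ≤ 9t³`, `t = Σ‖a_k‖ ≤ 1/4`); the rectangle holonomy as four straight-line
holonomies (`walkHolonomy_rectWalk`, `lineHol`) and these as exponential LIST products of the (signed) chart coordinates (`rho_lineHol_eq_listProd`,
`rho_lineHol_inv_eq_listProd`: `ρ(expChart ρ a) = e^{lieIso ρ a}`, `ρ(g⁻¹) = (ρ g)⁻¹ = e^{−lieIso ρ a}`); the signed perimeter sum of the coordinates
= the surface sum of their linear circulations (discrete Stokes `sum_rectSurface_plaquetteCurl`, colour by colour); `‖v‖² = Σ_c v_c²`.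

This is the chart-level input «loop cost = quadratic surrogate + cubic» of the loop port of the one-scale engine (stubs E1a
`stub_innerFlatLagFloorG`, E1b `stub_innerDatumCovStabilityG`, E2 `stub_innerDatumMeanSmoothG` of the two crux skeletons): with `U = cfgTDE ρ H β ϑ t`
(coordinates `a_t`, `√β·(a_t)_c = glue ϑ'_c (mean ϑ'_c + t_c)` edgewise, the sibling's `sqrt_mul_sCirc_extDatum_eqE`) the surrogate is
`β⁻¹·½Σ_c (Σ_{p∈S} sCirc(glue ϑ'_c (mean ϑ'_c + t_c)) p)²` — the loop twin of `qObsDE`.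

No new definition; standard axioms.  HONEST LABEL: rung R2xi-G RECORD label (leaf `WeakCouplingRates.XiPow`, an UPPER bound on the lattice mass
gap); NOT the Clay mass gap; no summit statement is touched.

References: S. Chatterjee, arXiv:1602.01222 §11 (exponential coordinates near the identity); K. Wilson, PRD 10 (1974) (loop holonomies);
lattice Stokes for abelianised holonomies: E. Seiler, LNP 159 (1982) Ch. 2.
-/

set_option autoImplicit false

noncomputable section

open Finset
open scoped Matrix Matrix.Norms.Frobenius
open NormedSpace
open Literature.Probability.LatticeModels (Site)
open Literature.MathematicalPhysics.QuantumLattice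
open Literature.MathematicalPhysics.QuantumFieldTheory
open Literature.MathematicalPhysics.QuantumFieldTheory.LatticeMaxwell
open Summit.QuantumFields.YangMills.Theorems.FreeEnergyLogCoefficient
open Summit.QuantumFields.YangMills.Theorems.ColdBoxAllGroups (rho_expChart_inv norm_sq_eq_sum_sq)

namespace Summit.QuantumFields.YangMills.Theorems.SoftLoopLongLag

/-! ## §1 List sums / products over `List.range` -/

/-- `Σ_{s ∈ List.range n} f s = Σ_{s ∈ Finset.range n} f s`. -/
theorem listSum_map_range {M : Type*} [AddCommMonoid M] (f : ℕ → M) (n : ℕ) :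
    ((List.range n).map f).sum = ∑ s ∈ Finset.range n, f s := by
  induction n with
  | zero => simp
  | succ n ih => rw [List.range_succ, List.map_append, List.sum_append, ih, Finset.sum_range_succ]; simp

/-- The reversed range has the same sum. -/
theorem listSum_map_reverse_range {M : Type*} [AddCommMonoid M] (f : ℕ → M) (n : ℕ) :
    ((List.range n).reverse.map f).sum = ∑ s ∈ Finset.range n, f s := by
  rw [List.map_reverse, List.sum_reverse, listSum_map_range]

/-- Peeling the first factor of a product over `List.range (n+1)`. -/
theorem listProd_map_range_succ {M : Type*} [Monoid M] (f : ℕ → M) (n : ℕ) :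
    ((List.range (n + 1)).map f).prod = f 0 * ((List.range n).map (f ∘ Nat.succ)).prod := by
  rw [List.range_succ_eq_map, List.map_cons, List.prod_cons, List.map_map]

/-- Peeling the last factor of a product over the REVERSED `List.range (n+1)`. -/
theorem listProd_map_reverse_range_succ {M : Type*} [Monoid M] (f : ℕ → M) (n : ℕ) :
    ((List.range (n + 1)).reverse.map f).prod = ((List.range n).reverse.map (f ∘ Nat.succ)).prod * f 0 := by
  rw [List.range_succ_eq_map, List.reverse_cons, List.map_append, List.prod_append, List.map_singleton, List.prod_singleton,
    ← List.map_reverse, List.map_map]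

/-- The norms of a mapped range all bounded by `m` sum to at most `n·m`. -/
theorem listSum_norm_map_range_le {E' : Type*} [SeminormedAddCommGroup E'] (f : ℕ → E') (n : ℕ) {m : ℝ} (h : ∀ s, ‖f s‖ ≤ m) :
    (((List.range n).map f).map (‖·‖)).sum ≤ n * m := by
  have hb : ∀ x ∈ ((List.range n).map f).map (‖·‖), x ≤ m := by
    intro x hx
    simp only [List.map_map, List.mem_map, List.mem_range, Function.comp_apply] at hx
    obtain ⟨s, -, rfl⟩ := hx
    exact h s
  have := List.sum_le_card_nsmul _ m hb
  simpa using this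

/-- The same for the reversed range. -/
theorem listSum_norm_map_reverse_range_le {E' : Type*} [SeminormedAddCommGroup E'] (f : ℕ → E') (n : ℕ) {m : ℝ}
    (h : ∀ s, ‖f s‖ ≤ m) : (((List.range n).reverse.map f).map (‖·‖)).sum ≤ n * m := by
  rw [List.map_reverse, List.map_reverse, List.sum_reverse]
  exact listSum_norm_map_range_le f n h

/-! ## §2 Straight-line holonomies of a chart configuration as exponential list products -/

section Chart

variable {N : ℕ} {G : Type*} [Group G] [TopologicalSpace G] [CompactSpace G] (ρ : G →* Matrix (Fin N) (Fin N) ℂ)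

/-- **`ρ` of a straight-line holonomy of a chart configuration is the ordered product of the link exponentials**:
`ρ(lineHol U i n y) = Π_{s<n} e^{lieIso ρ (a (y + s eᵢ, i))}` when `U e = expChart ρ (a e)`. -/
theorem rho_lineHol_eq_listProd (hρ : Continuous ρ) (U : LGConfig 4 G)
    (a : Literature.MathematicalPhysics.QuantumLattice.ZdEdge 4 → EuclideanSpace ℝ (Fin (dimE ρ))) (hU : ∀ e, U e = expChart ρ (a e))
    (i : Fin 4) : ∀ (n : ℕ) (y : Site 4),
      ρ (lineHol U i n y) = ((List.range n).map fun s : ℕ => exp (lieIso ρ (a (y + Pi.single i (s : ℤ), i)))).prod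
  | 0, y => by simp
  | n + 1, y => by
      rw [lineHol_succ, map_mul, hU, rho_expChart ρ hρ, rho_lineHol_eq_listProd hρ U a hU i n (y + Pi.single i 1),
        listProd_map_range_succ]
      congr 1
      · simp
      · refine congrArg List.prod (List.map_congr_left fun s _ => ?_)
        simp only [Function.comp_apply, Nat.cast_succ, add_assoc, ← Pi.single_add, add_comm (1 : ℤ)]

/-- **`ρ` of the INVERSE straight-line holonomy is the reversed product of the exponentials of the NEGATED coordinates**:
`ρ((lineHol U i n y)⁻¹) = Π_{s = n−1, …, 0} e^{lieIso ρ (−a (y + s eᵢ, i))}`. -/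
theorem rho_lineHol_inv_eq_listProd (hρ : Continuous ρ) (U : LGConfig 4 G)
    (a : Literature.MathematicalPhysics.QuantumLattice.ZdEdge 4 → EuclideanSpace ℝ (Fin (dimE ρ))) (hU : ∀ e, U e = expChart ρ (a e))
    (i : Fin 4) : ∀ (n : ℕ) (y : Site 4),
      ρ (lineHol U i n y)⁻¹ = ((List.range n).reverse.map fun s : ℕ => exp (lieIso ρ (-a (y + Pi.single i (s : ℤ), i)))).prod
  | 0, y => by simp
  | n + 1, y => by
      rw [lineHol_succ, mul_inv_rev, map_mul, hU, rho_expChart_inv ρ hρ, ← map_neg,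
        rho_lineHol_inv_eq_listProd hρ U a hU i n (y + Pi.single i 1), listProd_map_reverse_range_succ]
      congr 1
      · refine congrArg List.prod (List.map_congr_left fun s _ => ?_)
        simp only [Function.comp_apply, Nat.cast_succ, add_assoc, ← Pi.single_add, add_comm (1 : ℤ)]
      · simp

/-! ## §3 The rectangle: holonomy as ONE list product, its signed perimeter sum, and the surface fluxes -/

/-- **`ρ` of the rectangle holonomy is the exponential list product of the signed chart coordinates around the perimeter** (sides
`A = [x, x+Reᵢ)`, `B`, then `C`, `D` backwards with negated coordinates). -/
theorem rho_walkHolonomy_rectWalk_eq_listProd (hρ : Continuous ρ) (U : LGConfig 4 G)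
    (a : Literature.MathematicalPhysics.QuantumLattice.ZdEdge 4 → EuclideanSpace ℝ (Fin (dimE ρ))) (hU : ∀ e, U e = expChart ρ (a e))
    (x : Site 4) (i j : Fin 4) (R T : ℕ) :
    ρ (walkHolonomy U (rectWalk x i j R T)) =
      ((((List.range R).map fun s : ℕ => a (x + Pi.single i (s : ℤ), i)) ++
        ((List.range T).map fun s : ℕ => a (x + Pi.single i (R : ℤ) + Pi.single j (s : ℤ), j)) ++
        ((List.range R).reverse.map fun s : ℕ => -a (x + Pi.single j (T : ℤ) + Pi.single i (s : ℤ), i)) ++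
        ((List.range T).reverse.map fun s : ℕ => -a (x + Pi.single j (s : ℤ), j))).map fun v => exp (lieIso ρ v)).prod := by
  rw [Literature.MathematicalPhysics.QuantumLattice.walkHolonomy_rectWalk, map_mul, map_mul, map_mul, rho_lineHol_eq_listProd ρ hρ U a hU, rho_lineHol_eq_listProd ρ hρ U a hU,
    rho_lineHol_inv_eq_listProd ρ hρ U a hU, rho_lineHol_inv_eq_listProd ρ hρ U a hU]
  simp only [List.map_append, List.prod_append, List.map_map, List.map_reverse, mul_assoc]
  rfl

omit [TopologicalSpace G] [CompactSpace G] in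
/-- The signed perimeter sum of the coordinate list: `Σ_A a + Σ_B a − Σ_C a − Σ_D a`. -/
theorem listSum_perimeter_eq (a : Literature.MathematicalPhysics.QuantumLattice.ZdEdge 4 → EuclideanSpace ℝ (Fin (dimE ρ)))
    (x : Site 4) (i j : Fin 4) (R T : ℕ) :
    (((List.range R).map fun s : ℕ => a (x + Pi.single i (s : ℤ), i)) ++
        ((List.range T).map fun s : ℕ => a (x + Pi.single i (R : ℤ) + Pi.single j (s : ℤ), j)) ++
        ((List.range R).reverse.map fun s : ℕ => -a (x + Pi.single j (T : ℤ) + Pi.single i (s : ℤ), i)) ++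
        ((List.range T).reverse.map fun s : ℕ => -a (x + Pi.single j (s : ℤ), j))).sum =
      (∑ s ∈ Finset.range R, a (x + Pi.single i (s : ℤ), i)) +
        (∑ s ∈ Finset.range T, a (x + Pi.single i (R : ℤ) + Pi.single j (s : ℤ), j)) -
        (∑ s ∈ Finset.range R, a (x + Pi.single j (T : ℤ) + Pi.single i (s : ℤ), i)) -
        (∑ s ∈ Finset.range T, a (x + Pi.single j (s : ℤ), j)) := by
  rw [List.sum_append, List.sum_append, List.sum_append, listSum_map_range, listSum_map_range, listSum_map_reverse_range,
    listSum_map_reverse_range, Finset.sum_neg_distrib, Finset.sum_neg_distrib]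
  abel

omit [TopologicalSpace G] [CompactSpace G] in
/-- **Signed perimeter sum = surface flux, colour by colour** (discrete Stokes on the `R×T` rectangle in the `(1,2)` plane): the colour-`c`
component of `Σ_A a + Σ_B a − Σ_C a − Σ_D a` is `Σ_{p ∈ rectSurface x R T} sCirc (e ↦ (a e)_c) p`. -/
theorem perimeterSum_apply_eq_sum_sCirc (a : Literature.MathematicalPhysics.QuantumLattice.ZdEdge 4 → EuclideanSpace ℝ (Fin (dimE ρ)))
    (x : Site 4) (R T : ℕ) (c : Fin (dimE ρ)) :
    ((∑ s ∈ Finset.range R, a (x + Pi.single 1 (s : ℤ), 1)) +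
        (∑ s ∈ Finset.range T, a (x + Pi.single 1 (R : ℤ) + Pi.single 2 (s : ℤ), 2)) -
        (∑ s ∈ Finset.range R, a (x + Pi.single 2 (T : ℤ) + Pi.single 1 (s : ℤ), 1)) -
        (∑ s ∈ Finset.range T, a (x + Pi.single 2 (s : ℤ), 2))) c =
      ∑ p ∈ rectSurface x R T, sCirc (fun e => a e c) ((p.1, p.2.1.1, p.2.1.2) : Plaq 4) := by
  have hcurl : ∀ p : ZdPlaquette 4, sCirc (fun e => a e c) ((p.1, p.2.1.1, p.2.1.2) : Plaq 4) = plaquetteCurl (fun e => a e c) p :=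
    fun p => by rw [plaquetteCurl_eq]; rfl
  simp_rw [hcurl]
  rw [sum_rectSurface_plaquetteCurl]
  simp only [WithLp.ofLp_sub, WithLp.ofLp_add, WithLp.ofLp_sum, Pi.sub_apply, Pi.add_apply, Finset.sum_apply,
    Finset.sum_sub_distrib]
  have h3 : ∀ s : ℕ, x + Pi.single 2 (T : ℤ) + Pi.single 1 (s : ℤ) = x + Pi.single 1 (s : ℤ) + Pi.single 2 (T : ℤ) := fun s => by
    abel
  simp only [h3]
  ring

omit [TopologicalSpace G] [CompactSpace G] in
/-- The perimeter norm sum is at most `2(R+T)·m` when every coordinate has norm `≤ m`. -/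
theorem listSum_norm_perimeter_le (a : Literature.MathematicalPhysics.QuantumLattice.ZdEdge 4 → EuclideanSpace ℝ (Fin (dimE ρ)))
    (x : Site 4) (i j : Fin 4) (R T : ℕ) {m : ℝ} (ha : ∀ e, ‖a e‖ ≤ m) :
    ((((List.range R).map fun s : ℕ => a (x + Pi.single i (s : ℤ), i)) ++
        ((List.range T).map fun s : ℕ => a (x + Pi.single i (R : ℤ) + Pi.single j (s : ℤ), j)) ++
        ((List.range R).reverse.map fun s : ℕ => -a (x + Pi.single j (T : ℤ) + Pi.single i (s : ℤ), i)) ++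
        ((List.range T).reverse.map fun s : ℕ => -a (x + Pi.single j (s : ℤ), j))).map (‖·‖)).sum ≤ 2 * ((R : ℝ) + T) * m := by
  rw [List.map_append, List.map_append, List.map_append, List.sum_append, List.sum_append, List.sum_append]
  have h1 := listSum_norm_map_range_le (fun s : ℕ => a (x + Pi.single i (s : ℤ), i)) R (fun s => ha _)
  have h2 := listSum_norm_map_range_le (fun s : ℕ => a (x + Pi.single i (R : ℤ) + Pi.single j (s : ℤ), j)) T (fun s => ha _)
  have h3 := listSum_norm_map_reverse_range_le (fun s : ℕ => -a (x + Pi.single j (T : ℤ) + Pi.single i (s : ℤ), i)) R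
    (m := m) (fun s => by rw [norm_neg]; exact ha _)
  have h4 := listSum_norm_map_reverse_range_le (fun s : ℕ => -a (x + Pi.single j (s : ℤ), j)) T
    (m := m) (fun s => by rw [norm_neg]; exact ha _)
  linarith

/-! ## §4 The loop cost is the half-sum of squared surface fluxes up to the cubic remainder -/

/-- **R3-loop — the cost of an `R×T` Wilson loop of a chart configuration** (continuous unitary-valued `ρ`, every compact `G`): if
`U e = expChart ρ (a e)` with `‖a e‖ ≤ m` for every edge and `2(R+T)·m ≤ 1/4`, then
`|(N − Re tr ρ(hol_{rectWalk x 1 2 R T}(U))) − ½Σ_c (Σ_{p ∈ rectSurface x R T} sCirc (e ↦ (a e)_c) p)²| ≤ 9·(2(R+T)·m)³`. [folklore] -/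
theorem abs_loopCost_sub_half_sum_sq_le_of_eq_expChart (hρ : Continuous ρ) (U : LGConfig 4 G)
    (a : Literature.MathematicalPhysics.QuantumLattice.ZdEdge 4 → EuclideanSpace ℝ (Fin (dimE ρ))) (hU : ∀ e, U e = expChart ρ (a e))
    (x : Site 4) (R T : ℕ) {m : ℝ} (ha : ∀ e, ‖a e‖ ≤ m) (hm : 2 * ((R : ℝ) + T) * m ≤ 1 / 4) :
    |((N : ℝ) - (ρ (walkHolonomy U (rectWalk x 1 2 R T))).trace.re) -
        (1 / 2 : ℝ) * ∑ c, (∑ p ∈ rectSurface x R T, sCirc (fun e => a e c) ((p.1, p.2.1.1, p.2.1.2) : Plaq 4)) ^ 2| ≤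
      9 * (2 * ((R : ℝ) + T) * m) ^ 3 := by
  -- the perimeter list
  set l : List (EuclideanSpace ℝ (Fin (dimE ρ))) :=
    ((List.range R).map fun s : ℕ => a (x + Pi.single 1 (s : ℤ), 1)) ++
      ((List.range T).map fun s : ℕ => a (x + Pi.single 1 (R : ℤ) + Pi.single 2 (s : ℤ), 2)) ++
      ((List.range R).reverse.map fun s : ℕ => -a (x + Pi.single 2 (T : ℤ) + Pi.single 1 (s : ℤ), 1)) ++
      ((List.range T).reverse.map fun s : ℕ => -a (x + Pi.single 2 (s : ℤ), 2)) with hl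
  have hm0 : 0 ≤ m := (norm_nonneg _).trans (ha ((x, 1) : Literature.MathematicalPhysics.QuantumLattice.ZdEdge 4))
  have ht : (l.map (‖·‖)).sum ≤ 2 * ((R : ℝ) + T) * m := listSum_norm_perimeter_le ρ a x 1 2 R T ha
  have ht0 : 0 ≤ (l.map (‖·‖)).sum :=
    List.sum_nonneg (by intro r hr; obtain ⟨v, -, rfl⟩ := List.mem_map.1 hr; exact norm_nonneg _)
  have key := abs_cost_expChart_listProd_sub_half_norm_sq_le ρ l (ht.trans hm)
  -- holonomy and flux in terms of `l`
  have hhol : ρ (walkHolonomy U (rectWalk x 1 2 R T)) = (l.map fun v => exp (lieIso ρ v)).prod :=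
    rho_walkHolonomy_rectWalk_eq_listProd ρ hρ U a hU x 1 2 R T
  have hflux : ∑ c, (∑ p ∈ rectSurface x R T, sCirc (fun e => a e c) ((p.1, p.2.1.1, p.2.1.2) : Plaq 4)) ^ 2 = ‖l.sum‖ ^ 2 := by
    rw [norm_sq_eq_sum_sq, hl, listSum_perimeter_eq ρ a x 1 2 R T]
    exact Finset.sum_congr rfl fun c _ => by rw [perimeterSum_apply_eq_sum_sCirc ρ a x R T c]
  rw [hhol, hflux, show (1 / 2 : ℝ) * ‖l.sum‖ ^ 2 = ‖l.sum‖ ^ 2 / 2 by ring]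
  refine key.trans ?_
  have := pow_le_pow_left₀ ht0 ht 3
  linarith

end Chart

/-! ## §5 The datum form: the loop cost of the chart configuration with datum `cfgTDE t` vs the loop quadratic surrogate -/

section Datum

open Literature.MathematicalPhysics.QuantumFieldTheory.AxialGauge
open Summit.QuantumFields.YangMills.Theorems.WeakCouplingRates
open Summit.QuantumFields.YangMills.Theorems.ColdBoxAllGroups

variable {N : ℕ} {G : Type*} [Group G] [TopologicalSpace G] [CompactSpace G] (ρ : G →* Matrix (Fin N) (Fin N) ℂ) {H : ℕ}

omit [TopologicalSpace G] [CompactSpace G] in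
/-- **Surface form of the circulation split T2a**: on a surface all of whose plaquettes touch the cold box, `√β ·` (colour-`c` surface flux of the
chart coordinates of `cfgTDE t`) `=` surface flux of `glue ϑ'_c (mean ϑ'_c + t_c)` (the sibling's `sqrt_mul_sCirc_extDatum_eqE`, summed). -/
theorem sqrt_mul_sum_sCirc_extDatum_eq {β : ℝ} (hβ : 0 < β)
    (ϑ : Fin (dimE ρ) → (Literature.MathematicalPhysics.QuantumLattice.ZdEdge 4 → ℝ))
    (hforest : ∀ x : Site 4, (∀ k : Fin 4, 1 ≤ x k ∧ x k + 1 ≤ 2 * (H : ℤ)) → ∀ c, ϑ c (x, 0) = 0)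
    (t : TSpaceD H (dimE ρ)) (c : Fin (dimE ρ)) {S : Finset (ZdPlaquette 4)}
    (hS : ∀ p ∈ S, p ∈ plaquettesTouching (boxEdges 4 (2 * H + 1))) :
    Real.sqrt β * ∑ p ∈ S, sCirc (fun e => extDatum (datVec ϑ) (unscaleTE H (dimE ρ) β (t + meanTE H (dimE ρ) β ϑ)) e c)
        ((p.1, p.2.1.1, p.2.1.2) : Plaq 4) =
      ∑ p ∈ S, sCirc (glue (pin := fun e => e ∉ dirFreeEdges H) dirCorner (2 * H + 3) (sdatE β ϑ c)
        (mean (fun e => e ∉ dirFreeEdges H) dirCorner (2 * H + 3) (sdatE β ϑ c) + WithLp.ofLp (t c))) ((p.1, p.2.1.1, p.2.1.2) : Plaq 4) := by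
  rw [Finset.mul_sum]
  exact Finset.sum_congr rfl fun p hp =>
    sqrt_mul_sCirc_extDatum_eqE hβ ϑ hforest t c (p := ((p.1, p.2.1.1, p.2.1.2) : Plaq 4)) (touching_edges_mem_enlarged (hS p hp))

/-- **R3-loop with datum**: if every chart coordinate of `cfgTDE ρ H β ϑ t` has norm `≤ m` (`ϑ = 0` on the temporal forest, `β > 0`,
continuous unitary-valued `ρ`), then for every `R×T` rectangle in the `(1,2)` plane whose spanning surface consists of plaquettes touching
the cold box and with `2(R+T)·m ≤ 1/4`,
`|β·(N − Re tr ρ(hol_{rectWalk x 1 2 R T}(cfgTDE t))) − ½Σ_c (Σ_{p ∈ rectSurface x R T} sCirc (glue ϑ'_c (mean ϑ'_c + t_c)) p)²| ≤ 9·β·(2(R+T)·m)³`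
— the loop twin of `abs_beta_mul_plaqCostAt_sub_qObsDE_le` (the surrogate is the loop analogue of `qObsDE`). [folklore] -/
theorem abs_beta_mul_loopCost_sub_loopSurrogate_le (hρ : Continuous ρ) {β m : ℝ} (hβ : 0 < β)
    {ϑ : Fin (dimE ρ) → (Literature.MathematicalPhysics.QuantumLattice.ZdEdge 4 → ℝ)}
    (hforest : ∀ x : Site 4, (∀ k : Fin 4, 1 ≤ x k ∧ x k + 1 ≤ 2 * (H : ℤ)) → ∀ c, ϑ c (x, 0) = 0)
    (t : TSpaceD H (dimE ρ))
    (ha : ∀ e, ‖extDatum (datVec ϑ) (unscaleTE H (dimE ρ) β (t + meanTE H (dimE ρ) β ϑ)) e‖ ≤ m)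
    (x : Site 4) (R T : ℕ) (hm : 2 * ((R : ℝ) + T) * m ≤ 1 / 4)
    (hS : ∀ p ∈ rectSurface x R T, p ∈ plaquettesTouching (boxEdges 4 (2 * H + 1))) :
    |β * ((N : ℝ) - (ρ (walkHolonomy (cfgTDE ρ H β ϑ t) (rectWalk x 1 2 R T))).trace.re) -
        (1 / 2 : ℝ) * ∑ c, (∑ p ∈ rectSurface x R T,
          sCirc (glue (pin := fun e => e ∉ dirFreeEdges H) dirCorner (2 * H + 3) (sdatE β ϑ c)
            (mean (fun e => e ∉ dirFreeEdges H) dirCorner (2 * H + 3) (sdatE β ϑ c) + WithLp.ofLp (t c)))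
            ((p.1, p.2.1.1, p.2.1.2) : Plaq 4)) ^ 2| ≤ 9 * β * (2 * ((R : ℝ) + T) * m) ^ 3 := by
  set a := extDatum (datVec ϑ) (unscaleTE H (dimE ρ) β (t + meanTE H (dimE ρ) β ϑ)) with hadef
  have hU : ∀ e, cfgTDE ρ H β ϑ t e = expChart ρ (a e) := fun e => rfl
  have key := abs_loopCost_sub_half_sum_sq_le_of_eq_expChart ρ hρ (cfgTDE ρ H β ϑ t) a hU x R T ha hm
  have hsur : ∑ c, (∑ p ∈ rectSurface x R T,
      sCirc (glue (pin := fun e => e ∉ dirFreeEdges H) dirCorner (2 * H + 3) (sdatE β ϑ c)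
        (mean (fun e => e ∉ dirFreeEdges H) dirCorner (2 * H + 3) (sdatE β ϑ c) + WithLp.ofLp (t c)))
        ((p.1, p.2.1.1, p.2.1.2) : Plaq 4)) ^ 2 =
      β * ∑ c, (∑ p ∈ rectSurface x R T, sCirc (fun e => a e c) ((p.1, p.2.1.1, p.2.1.2) : Plaq 4)) ^ 2 := by
    rw [Finset.mul_sum]
    refine Finset.sum_congr rfl fun c _ => ?_
    rw [← sqrt_mul_sum_sCirc_extDatum_eq ρ hβ ϑ hforest t c hS, mul_pow, Real.sq_sqrt hβ.le]
  rw [hsur, show β * ((N : ℝ) - (ρ (walkHolonomy (cfgTDE ρ H β ϑ t) (rectWalk x 1 2 R T))).trace.re) -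
      (1 / 2 : ℝ) * (β * ∑ c, (∑ p ∈ rectSurface x R T, sCirc (fun e => a e c) ((p.1, p.2.1.1, p.2.1.2) : Plaq 4)) ^ 2) =
    β * (((N : ℝ) - (ρ (walkHolonomy (cfgTDE ρ H β ϑ t) (rectWalk x 1 2 R T))).trace.re) -
      (1 / 2 : ℝ) * ∑ c, (∑ p ∈ rectSurface x R T, sCirc (fun e => a e c) ((p.1, p.2.1.1, p.2.1.2) : Plaq 4)) ^ 2) by ring,
    abs_mul, abs_of_pos hβ]
  calc β * _ ≤ β * (9 * (2 * ((R : ℝ) + T) * m) ^ 3) := mul_le_mul_of_nonneg_left key hβ.le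
    _ = 9 * β * (2 * ((R : ℝ) + T) * m) ^ 3 := by ring

end Datum

end Summit.QuantumFields.YangMills.Theorems.SoftLoopLongLag

end
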